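import Literature.Analysis.FluidPDE.PotentialFlowParabolicExterior
import Literature.Analysis.FluidPDE.ParasiticSlabFlow
import HarnessLib

/-!
# s25-3 probed (crux `TypeITraceScarL3`, stmt-NavierStokesRegularity-18385): exterior backward uniqueness with
# Type-I coefficients — the coefficient-blind (abstract) and the velocity versions FAIL

Negative-lane helper of the disprover seat `cdisprove-stmt-NavierStokesRegularity-18385` (`--supports` the item;
crux work file `Cruxes/TypeITraceScarL3/Disproof.lean`, where the three typed layers `AbstractBUTypeIZeroOrder`,
`ExteriorVelocityBUTypeI`, `ExteriorVorticityBUTypeI` of seed s25-3 are stated as `Prop`s and the first two are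
negated by the two theorems below).  After C2 (`confined_of_exterior_irrotational`, p587698) the open content of
Stub C `stub_no_spreadExtinctApex` is C1 «every SPREAD extinct Type-I apex is irrotational on an exterior late
region» — an NS-specific exterior backward uniqueness statement ACROSS the final time with scale-critical
(Type-I) coefficients (nsreg-p2 ROUND-25 seed s25-3; director-ns req59 (iii)).  Two cheap probes, both theorems
with explicit witnesses and no definitions:

* `exists_typeICoeff_parabolicIneq_nullTop_ne_zero` — the coefficient-blind parabolic inequality
  `|∂ₛw − Δw| ≤ (C/(−s))|w| + (C/√(−s))|∇w|` on the exterior slab `]−1,0[ × (closedBall 0 1)ᶜ` does NOT force a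
  bounded `w` with null top to vanish: `w(s, y) = −s` has `|∂ₛw − Δw| = 1 = (−s)⁻¹|w|` (`C = 1`).  This is the
  verbatim transfer of ESS 2003 Thm 5.1 (stated and true for BOUNDED coefficients `M(|w| + |∇w|)`) to the
  coefficients `|∇U| ≤ C/(−s)`, `|U| ≤ C/√(−s)` that the vorticity equation `∂ₛω − Δω = ω·∇U − U·∇ω` of a Type-I
  apex has: the zeroth-order coefficient is critical, so a proof of C1 must use the STRUCTURE of the right-hand
  side (e.g. `ω = curl U`, `div U = 0`), not only its size.
* `exists_exteriorNS_typeIRate_irrotational_nullTop_ne_zero` — VELOCITY backward uniqueness fails even for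
  exact, irrotational flows: Serrin's potential flow `u = √(−s)∇Γ(y)` (tree `dipoleFlow 1`,
  `PotentialFlowParabolicExterior.lean`, written for route item `ScarRigidity`) is a classical Navier–Stokes flow
  on `]−1,0[ × (closedBall 0 1)ᶜ` with `‖u‖ ≤ √(−s)/(4π)` (so the rate `1/√(−s)` and a uniformly, hence weakly,
  null top), `curl u = 0`, and `u ≠ 0`.  So «irrotational on an exterior region» (C1's conclusion) is the right
  target of an exterior argument; `U = 0` there needs the equations across the core `{‖y‖ ≤ R}`.

The vorticity version (T3-local: classical NS on the exterior slab, `‖U‖ ≤ C/√(−s)`, `‖∇U‖ ≤ C/(−s)`, weakly null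
top on the exterior ⇒ `curl U = 0` on some exterior slab) is OPEN and is only TYPED in the crux work file.
WHAT THIS IS NOT: not C1, not Stub C, not NS regularity (neither proved nor refuted here).  References:
L. Escauriaza, G. Seregin, V. Šverák, Russ. Math. Surveys 58 (2003), Thm 5.1 [EscauriazaSereginSverak2003];
J. Serrin, Arch. Rational Mech. Anal. 9 (1962) 187–195 (the example `u = a(t)∇h`) [Serrin1962].
-/

noncomputable section

set_option linter.dupNamespace false

namespace Summit.NavierStokesRegularity.NavierStokesRegularity.Theorems.TypeITraceScarL3.Negative

open MeasureTheory Set Function Filter Topology Metric TopologicalSpace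
open Literature.Analysis.FluidPDE
open scoped NNReal ENNReal InnerProductSpace RealInnerProductSpace Laplacian ContDiff

/-! ### (F-a) The coefficient-blind Type-I parabolic inequality has non-zero null-top solutions -/

/-- **(F-a)** On the exterior slab `]−1,0[ × (closedBall 0 1)ᶜ` there is a smooth `w` (namely `w(s,y) = −s`)
with `|∂ₛw − Δw| ≤ (−s)⁻¹|w| + (−s)^{−1/2}‖∇w‖`, `|w| ≤ 1`, `w(s, y) → 0` as `s → 0⁻` for every `y`, and
`w ≢ 0`: backward uniqueness across `s = 0` FAILS for parabolic inequalities with the scale-critical zeroth-order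
coefficient `C/(−s)` (contrast: ESS 2003 Thm 5.1, bounded coefficients). [folklore; EscauriazaSereginSverak2003 Thm 5.1 (contrast)] -/
theorem exists_typeICoeff_parabolicIneq_nullTop_ne_zero :
    ∃ w : ℝ → EuclideanSpace ℝ (Fin 3) → ℝ,
      ContDiffOn ℝ 2 (uncurry w)
        (Ioo (-1 : ℝ) 0 ×ˢ (closedBall (0 : EuclideanSpace ℝ (Fin 3)) 1)ᶜ) ∧
      (∀ s ∈ Ioo (-1 : ℝ) 0, ∀ y ∈ (closedBall (0 : EuclideanSpace ℝ (Fin 3)) 1)ᶜ,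
        |deriv (fun σ => w σ y) s - (Δ (w s)) y| ≤
          1 / (-s) * |w s y| + 1 / Real.sqrt (-s) * ‖gradient (w s) y‖) ∧
      (∀ s ∈ Ioo (-1 : ℝ) 0, ∀ y ∈ (closedBall (0 : EuclideanSpace ℝ (Fin 3)) 1)ᶜ, |w s y| ≤ 1) ∧
      (∀ y ∈ (closedBall (0 : EuclideanSpace ℝ (Fin 3)) 1)ᶜ,
        Tendsto (fun s => w s y) (𝓝[<] 0) (𝓝 0)) ∧
      ∃ s ∈ Ioo (-1 : ℝ) 0, ∃ y ∈ (closedBall (0 : EuclideanSpace ℝ (Fin 3)) 1)ᶜ, w s y ≠ 0 := by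
  refine ⟨fun s _ => -s, contDiff_fst.neg.contDiffOn, ?_, ?_, ?_, ?_⟩
  · intro s hs y _
    have hd : deriv (fun σ : ℝ => -σ) s = -1 := by
      rw [deriv_neg]
    have hΔ : (Δ (fun _ : EuclideanSpace ℝ (Fin 3) => -s)) y = 0 := by
      rw [InnerProductSpace.laplacian_const]; rfl
    have hg : gradient (fun _ : EuclideanSpace ℝ (Fin 3) => -s) y = 0 := gradient_fun_const _ _
    have hs0 : 0 < -s := by linarith [hs.2]
    rw [hd, hΔ, hg, norm_zero, mul_zero, add_zero, abs_of_pos hs0, sub_zero,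
      show |(-1 : ℝ)| = 1 by norm_num, one_div, inv_mul_cancel₀ hs0.ne']
  · intro s hs y _
    rw [abs_of_pos (by linarith [hs.2])]
    linarith [hs.1]
  · intro y _
    have : Tendsto (fun s : ℝ => -s) (𝓝 0) (𝓝 (-0)) := tendsto_neg (0 : ℝ)
    rw [neg_zero] at this
    exact this.mono_left nhdsWithin_le_nhds
  · refine ⟨-(1 / 2 : ℝ), ⟨by norm_num, by norm_num⟩, (2 : ℝ) • parasiticDir, ?_, by norm_num⟩
    rw [mem_compl_iff, mem_closedBall, dist_zero_right, norm_smul, norm_parasiticDir, mul_one,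
      Real.norm_eq_abs, abs_two, not_le]
    norm_num

/-! ### (F-b) An irrotational exterior Type-I Navier–Stokes flow with null top that is not zero -/

/-- The exterior slab over radius `1` lies in the parabolic exterior `Ω₁ = {√(−t) < ‖x‖}` of the tree. [folklore] -/
theorem exteriorSlab_subset_parabolicExterior :
    Ioo (-1 : ℝ) 0 ×ˢ (closedBall (0 : EuclideanSpace ℝ (Fin 3)) 1)ᶜ ⊆ parabolicExterior 1 := by
  rintro ⟨t, x⟩ ⟨⟨ht1, ht2⟩, hx⟩
  rw [mem_compl_iff, mem_closedBall, dist_zero_right, not_le] at hx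
  refine ⟨ht2, ?_⟩
  have hs : Real.sqrt (-t) ≤ 1 := by
    rw [Real.sqrt_le_one]; linarith
  show 1 * Real.sqrt (-t) < ‖x‖
  linarith

/-- The potential flow `√(−s)∇Γ` is irrotational off the origin: near `y ≠ 0` it is the gradient of the smooth
potential `√(−s)·Γ∞` (`Γ∞ = newtonFar`), and `curl ∇θ = 0`. [folklore; Serrin1962 the example u = a(t)∇h] -/
theorem curl_dipoleFlow_eq_zero (c s : ℝ) {y : EuclideanSpace ℝ (Fin 3)} (hy : 1 < ‖y‖) :
    curl (dipoleFlow c s) y = 0 := by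
  set θ : EuclideanSpace ℝ (Fin 3) → ℝ := fun z => sqrtAmp c s * newtonFar (1 / 2) 1 z with hθ
  have hΓ : ContDiff ℝ 2 (newtonFar ((1 : ℝ) / 2) 1) := by
    have := contDiff_newtonFar' one_pos 2
    norm_num at this
    exact_mod_cast this
  have hθ2 : ContDiff ℝ 2 θ := contDiff_const.mul hΓ
  have hgrad : ∀ z, gradient θ z = sqrtAmp c s • gradient (newtonFar ((1 : ℝ) / 2) 1) z := by
    intro z
    simp only [hθ, gradient]
    rw [fderiv_const_mul ((hΓ.differentiable (by norm_num)) z), map_smul]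
  have hev : dipoleFlow c s =ᶠ[𝓝 y] gradient θ := by
    have h1 := dipole_eventuallyEq_gradient_newtonFar one_pos hy
    filter_upwards [h1] with z hz
    rw [hgrad z, dipoleFlow, hz]
  have hcurl : curl (dipoleFlow c s) y = curl (gradient θ) y := by
    simp only [curl, hev.fderiv_eq]
  rw [hcurl]
  exact curl_gradient_eq_zero_holds θ hθ2 y

/-- **(F-b)** On the exterior slab `]−1,0[ × (closedBall 0 1)ᶜ` there is a classical Navier–Stokes flow
(`u = √(−s)∇Γ`, `p = Γ/(2√(−s)) − (−s)|∇Γ|²/2`; Serrin 1962) with the Type-I rate `‖u‖ ≤ 1/√(−s)`, irrotational,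
with `‖u(s, y)‖ ≤ √(−s)` (so its top is null uniformly, in particular weakly on the exterior), which is NOT zero:
exterior VELOCITY backward uniqueness with Type-I coefficients fails; only «irrotational» can be the target of an
exterior argument. [folklore; Serrin1962 the example u = a(t)∇h] -/
theorem exists_exteriorNS_typeIRate_irrotational_nullTop_ne_zero :
    ∃ (U : ℝ → EuclideanSpace ℝ (Fin 3) → EuclideanSpace ℝ (Fin 3))
      (P : ℝ → EuclideanSpace ℝ (Fin 3) → ℝ),
      IsClassicalNSSolutionOnRegion
        (Ioo (-1 : ℝ) 0 ×ˢ (closedBall (0 : EuclideanSpace ℝ (Fin 3)) 1)ᶜ) 1 0 U P ∧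
      (∀ s ∈ Ioo (-1 : ℝ) 0, ∀ y ∈ (closedBall (0 : EuclideanSpace ℝ (Fin 3)) 1)ᶜ,
        ‖U s y‖ ≤ 1 / Real.sqrt (-s)) ∧
      (∀ s ∈ Ioo (-1 : ℝ) 0, ∀ y ∈ (closedBall (0 : EuclideanSpace ℝ (Fin 3)) 1)ᶜ,
        curl (U s) y = 0) ∧
      (∀ s ∈ Ioo (-1 : ℝ) 0, ∀ y ∈ (closedBall (0 : EuclideanSpace ℝ (Fin 3)) 1)ᶜ,
        ‖U s y‖ ≤ Real.sqrt (-s)) ∧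
      (∀ φ : EuclideanSpace ℝ (Fin 3) → EuclideanSpace ℝ (Fin 3), ContDiff ℝ (⊤ : ℕ∞) φ →
        HasCompactSupport φ → tsupport φ ⊆ (closedBall (0 : EuclideanSpace ℝ (Fin 3)) 1)ᶜ →
        ∀ ε : ℝ, 0 < ε → ∃ s₀ : ℝ, s₀ < 0 ∧ ∀ s ∈ Ioo s₀ 0, |∫ y, ⟪U s y, φ y⟫| ≤ ε) ∧
      ∃ s ∈ Ioo (-1 : ℝ) 0, ∃ y ∈ (closedBall (0 : EuclideanSpace ℝ (Fin 3)) 1)ᶜ, U s y ≠ 0 := by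
  have hsub := exteriorSlab_subset_parabolicExterior
  have hopen : IsOpen (Ioo (-1 : ℝ) 0 ×ˢ (closedBall (0 : EuclideanSpace ℝ (Fin 3)) 1)ᶜ) :=
    isOpen_Ioo.prod isClosed_closedBall.isOpen_compl
  have hnorm : ∀ s ∈ Ioo (-1 : ℝ) 0, ∀ y ∈ (closedBall (0 : EuclideanSpace ℝ (Fin 3)) 1)ᶜ,
      ‖dipoleFlow 1 s y‖ ≤ Real.sqrt (-s) := by
    intro s hs y hy
    rw [mem_compl_iff, mem_closedBall, dist_zero_right, not_le] at hy
    have hy0 : y ≠ 0 := by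
      rintro rfl; rw [norm_zero] at hy; linarith
    have hπ : (3 : ℝ) < Real.pi := Real.pi_gt_three
    rw [norm_dipoleFlow 1 hy0, abs_one, one_mul]
    have hden : 1 ≤ 4 * Real.pi * ‖y‖ ^ 2 := by nlinarith
    calc Real.sqrt (-s) * (4 * Real.pi * ‖y‖ ^ 2)⁻¹ ≤ Real.sqrt (-s) * 1 := by
          gcongr
          exact inv_le_one_of_one_le₀ hden
      _ = Real.sqrt (-s) := mul_one _
  refine ⟨dipoleFlow 1, dipoleFlowPressure 1,
    (dipoleFlow_isClassical 1 zero_le_one).mono_of_isOpen hsub hopen, ?_, ?_, hnorm, ?_, ?_⟩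
  · intro s hs y hy
    have hσ : 0 < Real.sqrt (-s) := Real.sqrt_pos.2 (by linarith [hs.2])
    have hσ1 : Real.sqrt (-s) ≤ 1 := by rw [Real.sqrt_le_one]; linarith [hs.1]
    refine (hnorm s hs y hy).trans ?_
    rw [le_div_iff₀ hσ]
    nlinarith
  · intro s _ y hy
    rw [mem_compl_iff, mem_closedBall, dist_zero_right, not_le] at hy
    exact curl_dipoleFlow_eq_zero 1 s hy
  · intro φ _ _ _ ε hε
    set K : ℝ := ∫ y, ⟪dipole y, φ y⟫ with hK
    have hkey : ∀ s, ∫ y, ⟪dipoleFlow 1 s y, φ y⟫ = Real.sqrt (-s) * K := by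
      intro s
      have e : ∀ y, ⟪dipoleFlow 1 s y, φ y⟫ = Real.sqrt (-s) * ⟪dipole y, φ y⟫ := by
        intro y
        rw [dipoleFlow, sqrtAmp, one_mul, real_inner_smul_left]
      simp_rw [e]
      exact integral_const_mul _ _
    set η : ℝ := ε / (|K| + 1) with hη
    have hη0 : 0 < η := by positivity
    refine ⟨-(min (1 / 2) (η ^ 2)), by
      have : 0 < min (1 / 2 : ℝ) (η ^ 2) := lt_min (by norm_num) (by positivity)
      linarith, fun s hs => ?_⟩
    rw [hkey, abs_mul, abs_of_nonneg (Real.sqrt_nonneg _)]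
    have hsη : -s < η ^ 2 := by
      have := hs.1
      have hmin : min (1 / 2 : ℝ) (η ^ 2) ≤ η ^ 2 := min_le_right _ _
      linarith
    have hsq : Real.sqrt (-s) < η := by
      rw [Real.sqrt_lt' hη0]; exact hsη
    calc Real.sqrt (-s) * |K| ≤ η * |K| := by gcongr
      _ = ε * (|K| / (|K| + 1)) := by rw [hη]; ring
      _ ≤ ε * 1 := by
          gcongr
          rw [div_le_one (by positivity)]; linarith
      _ = ε := mul_one ε
  · refine ⟨-(1 / 2 : ℝ), ⟨by norm_num, by norm_num⟩, (2 : ℝ) • parasiticDir, ?_, ?_⟩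
    · rw [mem_compl_iff, mem_closedBall, dist_zero_right, norm_smul, norm_parasiticDir, mul_one,
        Real.norm_eq_abs, abs_two, not_le]
      norm_num
    · have hmem : ((-(1 / 2 : ℝ)), (2 : ℝ) • parasiticDir) ∈ parabolicExterior 1 := by
        refine hsub ⟨⟨by norm_num, by norm_num⟩, ?_⟩
        rw [mem_compl_iff, mem_closedBall, dist_zero_right, norm_smul, norm_parasiticDir, mul_one,
          Real.norm_eq_abs, abs_two, not_le]
        norm_num
      exact dipoleFlow_ne_zero one_ne_zero zero_le_one hmem

end Summit.NavierStokesRegularity.NavierStokesRegularity.Theorems.TypeITraceScarL3.Negative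

end
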